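import Summits.SmoothPoincare4.SmoothPoincare4.Theses.CartanHadamardSwindle
import Literature.Geometry.Riemannian.ExponentialMap
import Literature.Geometry.Lorentzian.LeviCivitaCurvature
import HarnessLib

/-!
# Line `birth` — BC3 skeleton for the crux `CartanHadamardFour` (stmt-SmoothPoincare4-8095)

Route `CartanHadamardSwindle` (route-SmoothPoincare4-CartanHadamardSwindle), crux #2 `CartanHadamardFour` (rank 2,
"the NAMED FACT this line rests on"): a compact connected smooth 4-manifold `P` with a `C^∞` Riemannian metric `g`, a
Levi-Civita connection `cov` of `g` and `Rm(X,Y,Y,X) ≤ 0` (non-positive sectional curvature, Lee's sign) admits a map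
`π : ℝ⁴ → P` which is a covering map, surjective, and a `C^∞` local diffeomorphism (Lee 2018, Thm. 12.8, compact form).

Skeleton registrar (planner one-shot `skel-stmt-SmoothPoincare4-8095`, 2026-08-17; route re-audit bin REPAIRABLE).

**STATUS NOTICE.** The crux is, verbatim, the case `n = 4` of the Literature named fact
`Literature.Geometry.Riemannian.Lee2018_cartanHadamard_compact` (`Literature/Geometry/Riemannian/CartanHadamard.lean`), and that
fact is DISCHARGED in the tree (`Literature.Geometry.Riemannian.Lee2018_cartanHadamard_compact_holds`,
`Literature/Geometry/Riemannian/CartanHadamardCovering.lean`; grounder note on the item, 2026-08-15).  Hence the crux is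
PROVABLE NOW by the one-liner
`fun P _ _ _ _ _ _ _ g cov hg hcov hsec => Lee2018_cartanHadamard_compact_holds 4 P g cov hg hcov hsec`
(for a prover to land under `Theorems/` with `--workitem stmt-SmoothPoincare4-8095`; planners do not prove).  This file
deliberately does NOT import `CartanHadamardCovering` / `CartanHadamardConjugate`: the skeleton states the LINE, and each stub
names (in its docstring) the tree theorem that closes it.

THE LINE = Lee's printed proof of Thm. 12.8 (p. 357), cut at its two seams, specialised to the crux's binder form
(model `𝓡 4`, `P : Type`, `g.leviCivita` under `[g.HasLeviCivita]`):

* `stub_compactComplete` — compact Riemannian ⇒ geodesically complete (Lee Cor. 6.22; O'Neill Ch. 5 Cor. 23).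
  Closable by `PseudoRiemannianMetric.isGeodesicallyComplete_of_compactSpace` (`CompactComplete.lean`).  Size S.
* `stub_expImmersion` — THE CURVATURE STEP (load-bearing; the only place the sign of `Rm` enters): complete +
  `Rm(X,Y,Y,X) ≤ 0` ⇒ for every `p` and every `v ∈ T_pP = ℝ⁴`, `d(exp_p)_v` is injective — no point is conjugate to `p`
  (Lee Thm. 11.12 via the Jacobi equation, + Prop. 10.20: critical points of `exp_p` are conjugate points).  Closable by
  `CartanHadamard.mfderiv_expMap_injective` (`CartanHadamardConjugate.lean`) after supplying the
  `ContMDiffCovariantDerivative g.leviCivita 1 / ∞` instances from `g.isLocallyContMDiff_leviCivita_holds`.  Size S–M.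
* `stub_immersiveExpCovering` — THE TOPOLOGY STEP (curvature-free): on a compact connected `P` with complete
  `g.leviCivita`, an `exp_p` whose differential is injective everywhere is a `C^∞` local diffeomorphism (inverse function
  theorem), surjective, and a covering map (`exp_p^* g` on `T_pP` is complete — radial lines are geodesics / Gordon's
  criterion with `ρ = √(1 + |v|²)` and the Gauss lemma — and a local isometry from a complete manifold onto a connected one
  is a covering, Lee Thm. 6.23 / Ambrose).  Closable by `Literature.Topology.FourManifolds.isLocalDiffeomorphAt_of_mfderiv`
  + `CartanHadamard.isGeodesicallyComplete_comap_expMap` + `CartanHadamard.surjective_and_isCoveringMap_of_isGeodesicallyComplete`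
  (≈ 25 lines of instance plumbing, all present in `Lee2018_cartanHadamard_compact_holds`).  Size M.

Composition (`cartanHadamardFour_of_stubSigs`, sorry-free, axioms propext / Classical.choice / Quot.sound): given the crux's
data `(P, g, cov)`, install `g.hasLeviCivita`, transport `Rm_cov ≤ 0` to `Rm_{g.leviCivita} ≤ 0` by the uniqueness half of the
fundamental lemma (`IsLeviCivita.curvature_eq_riemann`, `2 ≤ ∞`), pick `p : P` (`ConnectedSpace ⇒ Nonempty`), and chain
stub 1 → stub 2 → stub 3 to get `π = exp_p`.  `CartanHadamardFour_of : CartanHadamardFour` feeds it the three stubs and concludes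
the crux BY NAME (`ledger skeleton check` shape: no hypotheses; `sorry` enters only through `stub_*`).

BC3 audit (registrar session, farm `lean check --json`): rc 0, errors 0, sorries 3 = the three `stub_*` (lines of the three
stub theorems), zero elsewhere; probes `stub → CartanHadamardFour` and `stub → SmoothPoincare4` by
`first | exact? | simpa | aesop` and by BC2's unfolding chain: 12/12 FAIL (+ 4/4 single-alternative reruns for the one chain
cut short by a heartbeat timeout) — no stub is cheaply the crux or the summit.  Why not: stub 1 has no covering content; stub 2
concludes injectivity of differentials only; stub 3 needs completeness and an everywhere-injective differential that nothing in
the crux's context supplies for free.  Costume check: no stub is the general-`n` fact (that WOULD be the crux in costume).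
Disproof used: none — `Cruxes/CartanHadamardFour/` had no workfiles at registration (`ledger crux ls`), and
`ledger negatives --problem SmoothPoincare4` lists 0 refuted statements (2026-08-17).  Typing checklist 4c: n/a (no thresholds,
integrals, determinantal or partition-function content); junk audit: `mfderiv` of a non-differentiable map is `0`, never
injective on `ℝ⁴`, so the immersion clauses are not vacuous; `expMap` is total (`expDomain_eq_univ`) under completeness.

References: Lee2018 (Thm. 12.8 pp. 356–357; Cor. 6.22; Thm. 6.23; Prop. 10.20; Thm. 11.12), ONeill1983 (Ch. 5 Cor. 23;
Ch. 7 Cor. 7.29; Ch. 10 Prop. 10 ff.), Gordon1973, doi:10.1007/978-3-319-91755-9.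
-/

noncomputable section

-- `Summit.<Summit>.<Problem>`: for the single-conjunct summit the duplicate component is mandated.
set_option linter.dupNamespace false
set_option linter.unusedVariables false

open scoped Manifold ContDiff Topology

namespace Summit.SmoothPoincare4.SmoothPoincare4.Cruxes.CartanHadamardFour.Birth

open Literature.Geometry.Lorentzian Literature.Geometry.Riemannian

/-! ## The three registered stubs -/

/-- **Stub 1 — a compact Riemannian manifold is geodesically complete** (Lee 2018 Cor. 6.22; O'Neill 1983 Ch. 5 Cor. 23):
for a smooth positive definite metric `g` on a compact (connected, Hausdorff, second countable) boundaryless smooth 4-manifold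
`P`, every `g.leviCivita`-geodesic extends to all of `ℝ`.  Why plausibly true: it is a theorem; in the tree
`PseudoRiemannianMetric.isGeodesicallyComplete_of_compactSpace (hn : 2 ≤ ∞) hg` closes it by `exact`.  Size S.
Sources: Lee2018 (Cor. 6.22), ONeill1983 (Ch. 5, Cor. 23), Gordon1973. -/
theorem stub_compactComplete :
    ∀ (P : Type) [TopologicalSpace P] [T2Space P] [SecondCountableTopology P]
    [ChartedSpace (EuclideanSpace ℝ (Fin 4)) P] [IsManifold (𝓡 4) ∞ P] [CompactSpace P] [ConnectedSpace P]
    (g : Literature.Geometry.Lorentzian.PseudoRiemannianMetric (𝓡 4) ∞ (EuclideanSpace ℝ (Fin 4)) (TangentSpace (𝓡 4) : P → Type _))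
    [g.HasLeviCivita], g.IsRiemannian →
    Literature.Geometry.Lorentzian.IsGeodesicallyComplete g.leviCivita := by
  sorry

/-- **Stub 2 — non-positive curvature ⇒ no conjugate points: every `d(exp_p)_v` is injective** (Lee 2018 Thm. 11.12 +
Prop. 10.20; THE LOAD-BEARING STUB, the only place the curvature sign is used).  Setting: `P` as in the crux, `g` smooth
Riemannian with `g.leviCivita` geodesically complete and `Rm(X,Y,Y,X) ≤ 0` for `g.leviCivita`; conclusion: for every base point
`p` and every `v ∈ T_pP = ℝ⁴` the differential at `v` of `exp_p : ℝ⁴ → P` is injective.  Why plausibly true: Jacobi-field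
monotonicity (`|J|²` is convex-increasing along `γ_v` when `sec ≤ 0`, so `J(1) = d(exp_p)_v(w) = 0` forces `w = 0`); in the
tree `CartanHadamard.mfderiv_expMap_injective hg hsec hcov₁ hc p v` closes it once the `ContMDiffCovariantDerivative
g.leviCivita 1 / ∞` instances and `hcov₁ : g.leviCivita.IsLocallyContMDiff 1` are installed from
`g.isLocallyContMDiff_leviCivita_holds` (verbatim as in `Lee2018_cartanHadamard_compact_holds`).  Not vacuous: a
non-differentiable `exp_p` would have `mfderiv = 0`, which is not injective on `ℝ⁴`.  Size S–M.
Sources: Lee2018 (Thm. 11.12, Prop. 10.20, Problem 10-7), ONeill1983 (Ch. 10, Prop. 10 ff.). -/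
theorem stub_expImmersion :
    ∀ (P : Type) [TopologicalSpace P] [T2Space P] [SecondCountableTopology P]
    [ChartedSpace (EuclideanSpace ℝ (Fin 4)) P] [IsManifold (𝓡 4) ∞ P] [CompactSpace P] [ConnectedSpace P]
    (g : Literature.Geometry.Lorentzian.PseudoRiemannianMetric (𝓡 4) ∞ (EuclideanSpace ℝ (Fin 4)) (TangentSpace (𝓡 4) : P → Type _))
    [g.HasLeviCivita], g.IsRiemannian →
    Literature.Geometry.Lorentzian.IsGeodesicallyComplete g.leviCivita →
    (∀ (x : P) (X Y : TangentSpace (𝓡 4) x), g.curvatureForm g.leviCivita x X Y Y X ≤ 0) →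
    ∀ (p : P) (v : EuclideanSpace ℝ (Fin 4)),
      Function.Injective (mfderiv (𝓡 4) (𝓡 4)
        (fun u : EuclideanSpace ℝ (Fin 4) ↦ Literature.Geometry.Riemannian.expMap g.leviCivita p (show TangentSpace (𝓡 4) p from u)) v) := by
  sorry

/-- **Stub 3 — an everywhere-immersive exponential map of a complete metric on a compact connected manifold is a surjective
covering map and a local diffeomorphism** (inverse function theorem + Lee 2018 Thm. 6.23 / Ambrose, with the completeness of
`exp_p^* g` from Cor. 6.20 or Gordon's criterion; curvature-free).  Setting: `P` as in the crux, `g` smooth Riemannian,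
`g.leviCivita` complete, `p : P`, and `d(exp_p)_v` injective for all `v`; conclusion: `exp_p : ℝ⁴ → P` is surjective, a covering
map (`IsCoveringMap`) and a `C^∞` local diffeomorphism.  Why plausibly true: standard ("no conjugate points from `p` on a complete
manifold ⇒ `exp_p` is a covering"); in the tree: `Literature.Topology.FourManifolds.isLocalDiffeomorphAt_of_mfderiv` with
`mfderivEquivOfInjective` (local diffeo, as in `CartanHadamard.isLocalDiffeomorph_expMap`), then
`CartanHadamard.isGeodesicallyComplete_comap_expMap` and `CartanHadamard.surjective_and_isCoveringMap_of_isGeodesicallyComplete`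
applied to `g.comap contMDiff_pullbackBilin_holds exp_p (contMDiff_expMap_infty hc p) hinj rfl`.  Size M.
Sources: Lee2018 (Thm. 6.23, Cor. 6.20, Thm. 12.8 proof p. 357), ONeill1983 (Ch. 7, Cor. 7.29), Gordon1973. -/
theorem stub_immersiveExpCovering :
    ∀ (P : Type) [TopologicalSpace P] [T2Space P] [SecondCountableTopology P]
    [ChartedSpace (EuclideanSpace ℝ (Fin 4)) P] [IsManifold (𝓡 4) ∞ P] [CompactSpace P] [ConnectedSpace P]
    (g : Literature.Geometry.Lorentzian.PseudoRiemannianMetric (𝓡 4) ∞ (EuclideanSpace ℝ (Fin 4)) (TangentSpace (𝓡 4) : P → Type _))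
    [g.HasLeviCivita], g.IsRiemannian →
    Literature.Geometry.Lorentzian.IsGeodesicallyComplete g.leviCivita →
    ∀ (p : P), (∀ v : EuclideanSpace ℝ (Fin 4), Function.Injective (mfderiv (𝓡 4) (𝓡 4)
        (fun u : EuclideanSpace ℝ (Fin 4) ↦ Literature.Geometry.Riemannian.expMap g.leviCivita p (show TangentSpace (𝓡 4) p from u)) v)) →
      Function.Surjective (fun u : EuclideanSpace ℝ (Fin 4) ↦ Literature.Geometry.Riemannian.expMap g.leviCivita p (show TangentSpace (𝓡 4) p from u)) ∧
      IsCoveringMap (fun u : EuclideanSpace ℝ (Fin 4) ↦ Literature.Geometry.Riemannian.expMap g.leviCivita p (show TangentSpace (𝓡 4) p from u)) ∧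
      IsLocalDiffeomorph (𝓡 4) (𝓡 4) ∞
        (fun u : EuclideanSpace ℝ (Fin 4) ↦ Literature.Geometry.Riemannian.expMap g.leviCivita p (show TangentSpace (𝓡 4) p from u)) := by
  sorry

/-! ## The composition (sorry-free): the three statements imply the crux -/

/-- **The three stub statements imply the body of `CartanHadamardFour`** — the real assembly of the line (Lee's proof of
Thm. 12.8 as a chain): transport the curvature hypothesis from the given Levi-Civita `cov` to `g.leviCivita`
(`IsLeviCivita.curvature_eq_riemann`), take a base point, and compose completeness → immersion → covering.  The conclusion is
the crux's body verbatim (head `∃`, so that `ledger skeleton check` takes `CartanHadamardFour_of` below, not this theorem, as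
the skeleton theorem). [folklore] -/
theorem cartanHadamardFour_of_stubSigs
    (h1 : ∀ (P : Type) [TopologicalSpace P] [T2Space P] [SecondCountableTopology P]
      [ChartedSpace (EuclideanSpace ℝ (Fin 4)) P] [IsManifold (𝓡 4) ∞ P] [CompactSpace P] [ConnectedSpace P]
      (g : Literature.Geometry.Lorentzian.PseudoRiemannianMetric (𝓡 4) ∞ (EuclideanSpace ℝ (Fin 4)) (TangentSpace (𝓡 4) : P → Type _))
      [g.HasLeviCivita], g.IsRiemannian →
      Literature.Geometry.Lorentzian.IsGeodesicallyComplete g.leviCivita)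
    (h2 : ∀ (P : Type) [TopologicalSpace P] [T2Space P] [SecondCountableTopology P]
      [ChartedSpace (EuclideanSpace ℝ (Fin 4)) P] [IsManifold (𝓡 4) ∞ P] [CompactSpace P] [ConnectedSpace P]
      (g : Literature.Geometry.Lorentzian.PseudoRiemannianMetric (𝓡 4) ∞ (EuclideanSpace ℝ (Fin 4)) (TangentSpace (𝓡 4) : P → Type _))
      [g.HasLeviCivita], g.IsRiemannian →
      Literature.Geometry.Lorentzian.IsGeodesicallyComplete g.leviCivita →
      (∀ (x : P) (X Y : TangentSpace (𝓡 4) x), g.curvatureForm g.leviCivita x X Y Y X ≤ 0) →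
      ∀ (p : P) (v : EuclideanSpace ℝ (Fin 4)),
        Function.Injective (mfderiv (𝓡 4) (𝓡 4)
          (fun u : EuclideanSpace ℝ (Fin 4) ↦ Literature.Geometry.Riemannian.expMap g.leviCivita p (show TangentSpace (𝓡 4) p from u)) v))
    (h3 : ∀ (P : Type) [TopologicalSpace P] [T2Space P] [SecondCountableTopology P]
      [ChartedSpace (EuclideanSpace ℝ (Fin 4)) P] [IsManifold (𝓡 4) ∞ P] [CompactSpace P] [ConnectedSpace P]
      (g : Literature.Geometry.Lorentzian.PseudoRiemannianMetric (𝓡 4) ∞ (EuclideanSpace ℝ (Fin 4)) (TangentSpace (𝓡 4) : P → Type _))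
      [g.HasLeviCivita], g.IsRiemannian →
      Literature.Geometry.Lorentzian.IsGeodesicallyComplete g.leviCivita →
      ∀ (p : P), (∀ v : EuclideanSpace ℝ (Fin 4), Function.Injective (mfderiv (𝓡 4) (𝓡 4)
          (fun u : EuclideanSpace ℝ (Fin 4) ↦ Literature.Geometry.Riemannian.expMap g.leviCivita p (show TangentSpace (𝓡 4) p from u)) v)) →
        Function.Surjective (fun u : EuclideanSpace ℝ (Fin 4) ↦ Literature.Geometry.Riemannian.expMap g.leviCivita p (show TangentSpace (𝓡 4) p from u)) ∧
        IsCoveringMap (fun u : EuclideanSpace ℝ (Fin 4) ↦ Literature.Geometry.Riemannian.expMap g.leviCivita p (show TangentSpace (𝓡 4) p from u)) ∧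
        IsLocalDiffeomorph (𝓡 4) (𝓡 4) ∞
          (fun u : EuclideanSpace ℝ (Fin 4) ↦ Literature.Geometry.Riemannian.expMap g.leviCivita p (show TangentSpace (𝓡 4) p from u))) :
    ∀ (P : Type) [TopologicalSpace P] [T2Space P] [SecondCountableTopology P]
      [ChartedSpace (EuclideanSpace ℝ (Fin 4)) P] [IsManifold (𝓡 4) ∞ P] [CompactSpace P] [ConnectedSpace P]
      (g : Literature.Geometry.Lorentzian.PseudoRiemannianMetric (𝓡 4) ∞ (EuclideanSpace ℝ (Fin 4)) (TangentSpace (𝓡 4) : P → Type _))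
      (cov : CovariantDerivative (𝓡 4) (EuclideanSpace ℝ (Fin 4)) (TangentSpace (𝓡 4) : P → Type _)),
      g.IsRiemannian → g.IsLeviCivita cov →
      (∀ (x : P) (X Y : TangentSpace (𝓡 4) x), g.curvatureForm cov x X Y Y X ≤ 0) →
      ∃ π : EuclideanSpace ℝ (Fin 4) → P,
        IsCoveringMap π ∧ Function.Surjective π ∧ IsLocalDiffeomorph (𝓡 4) (𝓡 4) ∞ π := by
  intro P _ _ _ _ _ _ _ g cov hg hcov hsec
  haveI : g.HasLeviCivita := g.hasLeviCivita
  have h2le : (2 : ℕ∞ω) ≤ ∞ := WithTop.coe_le_coe.2 le_top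
  -- the curvature of `cov` is that of `g.leviCivita` (uniqueness half of the fundamental lemma)
  have hsec' : ∀ (x : P) (X Y : TangentSpace (𝓡 4) x),
      g.curvatureForm g.leviCivita x X Y Y X ≤ 0 := by
    intro x X Y
    have h := hsec x X Y
    simp only [PseudoRiemannianMetric.curvatureForm] at h ⊢
    rw [hcov.curvature_eq_riemann h2le x] at h
    exact h
  -- Lee Cor. 6.22: the compact `P` is complete
  have hc : IsGeodesicallyComplete g.leviCivita := h1 P g hg
  -- a base point
  obtain ⟨p⟩ : Nonempty P := inferInstance
  -- Lee Thm. 11.12 + Prop. 10.20: `exp_p` is an immersion on all of `T_pP = ℝ⁴`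
  have hinj := h2 P g hg hc hsec' p
  -- Lee Thm. 6.23 (+ IFT, + completeness of `exp_p^* g`): `exp_p` is a surjective covering local diffeomorphism
  obtain ⟨hsurj, hcovm, hloc⟩ := h3 P g hg hc p hinj
  exact ⟨_, hcovm, hsurj, hloc⟩

/-- **THE SKELETON THEOREM: `CartanHadamardSwindle.CartanHadamardFour` BY NAME from the three declared stubs**
(`ledger skeleton check` shape: no hypotheses; `sorry` enters only through `stub_*`). [folklore] -/
theorem CartanHadamardFour_of :
    Summit.SmoothPoincare4.SmoothPoincare4.Theses.CartanHadamardSwindle.CartanHadamardFour :=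
  cartanHadamardFour_of_stubSigs stub_compactComplete stub_expImmersion stub_immersiveExpCovering

end Summit.SmoothPoincare4.SmoothPoincare4.Cruxes.CartanHadamardFour.Birth

end
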